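import Summits.Schanuel.Schanuel.Theorems.SoloInformedAPIntegrality

/-!
# Mixed integrality of 3-term-AP defects across THREE integer polynomials (Lemma M, algebraic core)

Solo-informed Schanuel seat, session s191 (2026-08-31); companion of
`SoloInformedAPIntegrality` (Lemma AE₃: ONE polynomial, price `a ^ (3 D²)`).  Here the three
slots of an inexact progression `x + z ≈ 2 m` carry the roots of three possibly different
integer polynomials `G₁, G₂, G₃ ∈ ℤ[X]` (left point: roots `ρ₁` of `G₁`; midpoint: roots `ρ₂`
of `G₂`; right point: roots `ρ₃` of `G₃`), and the defects are the linear forms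
`L t = ρ₁ t.1 + ρ₃ t.2.2 − 2 ρ₂ t.2.1`, `t ∈ Fin D₁ × Fin D₂ × Fin D₃`.

* `soloMI_exists_map_eq_C_mul_prod` — **the deformed product is an integer polynomial**:
  there is `P ∈ ℤ[X]` with
  `P = C (((-1)^D₁ a₁) ^ (D₂ D₃) · a₂ ^ (D₁ D₃) · a₃ ^ (D₁ D₂)) · ∏_t (X + C (L t))` over `K`
  (`a_s` the leading coefficients; every root `ρ₁ i` occurs in `D₂ D₃` of the forms, every
  `ρ₂ j` in `D₁ D₃`, every `ρ₃ k` in `D₁ D₂` — the exponents are these occurrence counts).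
* `soloMI_pow_mul_prod_eq_intCast` — **algebraic core**:
  `a₁ ^ (D₂ D₃) · a₂ ^ (D₁ D₃) · a₃ ^ (D₁ D₂) · ∏_{t : L t ≠ 0} L t ∈ ℤ`
  (the coefficient of `X ^ #{t : L t = 0}` of the polynomial above, up to sign).
* `soloMI_one_le_abs_pow_mul_prod_norm` — over `ℂ`, `G_s ≠ 0`:
  `1 ≤ |a₁| ^ (D₂ D₃) · |a₂| ^ (D₁ D₃) · |a₃| ^ (D₁ D₂) · ∏_{t : L t ≠ 0} ‖L t‖`.

Method (prefix `soloMI_`): the `ε`-deformed ITERATED RESULTANT, run entirely over the domain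
`S = K[X]` with Mathlib's `Polynomial.resultant_eq_prod_eval` (`f` splits ⇒
`Res(f, g; deg f, n) = lc(f) ^ n · ∏_{f(α)=0} g(α)`) and `Polynomial.resultant_map_map`:
`soloMI_map_resultant_eq` is the generic step (for `g ∈ ℤ[V][X]` of formal degree `≤ n` and a
ring map `φ : ℤ[V] → K[X]`, `φ (Res(G, g; D, n)) = C a ^ n · ∏_i (g.map φ)(C ρ_i)`), used
three times: `P₁ := G₁ ∘ (−X)`, `P₂ := Res_X(G₂, P₁(V − 2X); D₂, D₁) ∈ ℤ[V]`,
`P₃ := Res_X(G₃, P₂(V + X); D₃, D₁ D₂) ∈ ℤ[V]`, and `P₃ ↦ C κ · ∏_t (X + C (L t))` under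
`ℤ[V] → K[X]`.  (The one-polynomial file used the degree-bounded fundamental theorem of
symmetric polynomials instead; for three root families the resultant route is shorter.)

## Why (seat bookkeeping; pen side `work/s188/MIXED-AE3-note.md` §1, audited twice, s188/s189)

This is Lemma M (i) of the seat's note: the integrality input of the MIXED Lemma AE₃, which
prices inexact progressions whose three slots are served by different dyadic multiplicity
classes of one integer polynomial (`G₂ = F_j`, `G₁ = G₃ = F` and permutations) at
`D₂ D₃ log M₁ + D₁ D₃ log M₂ + D₁ D₂ log M₃ + D₁ D₂ D₃ log 4` instead of
`3 (D₁+D₂+D₃)² log M(G₁ G₂ G₃)`; the analytic form (Lemma M (ii)–(iii)) is the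
companion file `SoloInformedMixedAPAnalytic` (next in the seat's plan, `MIXED-AE3-note` §6).
Exponent pattern checked numerically beforehand (exact rational and `ℚ(√2,√3)` arithmetic,
`work/s188/mixed_ae3_sanity.py`, `work/s189/lemmaM_irrational_check.py`: integral in 17/17
cases, each exponent sharp).  Toy layer only (node
`RoyAdditiveDirichletExponent`, [cite: Roy2010, Thm 1.1]); nothing here bears on
`Literature.Periods.SchanuelConjecture`; the seat's verdict (no path) is unchanged.  Classical
device (resultants / symmetric functions, [cite: Baker1975, Ch. 8 §3, p. 84]); no novelty
claimed; Mathlib + the seat files only; no definitions; no literature hypotheses; standard axioms.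
-/

namespace Summit.Schanuel.Schanuel.Theorems

open Finset Polynomial

section RootEnumeration

variable {K : Type*} [Field K] [CharZero K] {D : ℕ}

/-- A root enumeration with multiplicity forces `G` to split over `K`. -/
theorem soloMI_splits_map (G : ℤ[X]) (hD : G.natDegree = D) (ρ : Fin D → K)
    (hρ : univ.val.map ρ = (G.map (Int.castRingHom K)).roots) :
    (G.map (Int.castRingHom K)).Splits := by
  rw [splits_iff_card_roots, ← hρ, Multiset.card_map, Finset.card_val, Finset.card_univ,
    Fintype.card_fin, natDegree_map_eq_of_injective (Int.castRingHom K).injective_int, hD]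

omit [CharZero K] in
/-- `G` pushed to `K[X][X]` is the `C`-image of `G` pushed to `K[X]`. -/
theorem soloMI_map_algebraMap_eq (G : ℤ[X]) :
    G.map (algebraMap ℤ K[X]) = (G.map (Int.castRingHom K)).map C := by
  rw [Polynomial.map_map]
  congr 1

/-- Over `S = K[X]`: `G(w) = C a · ∏_i (w − C ρ_i)` for every `w ∈ K[X]`. -/
theorem soloMI_eval_map_eq_prod (G : ℤ[X]) (hD : G.natDegree = D) (ρ : Fin D → K)
    (hρ : univ.val.map ρ = (G.map (Int.castRingHom K)).roots) (w : K[X]) :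
    (G.map (algebraMap ℤ K[X])).eval w = C (G.leadingCoeff : K) * ∏ i, (w - C (ρ i)) := by
  have hsplit := soloMI_splits_map G hD ρ hρ
  rw [soloMI_map_algebraMap_eq, (hsplit.map C).eval_eq_prod_roots,
    leadingCoeff_map_of_injective C_injective,
    leadingCoeff_map_of_injective (Int.castRingHom K).injective_int, eq_intCast,
    hsplit.roots_map C, ← hρ, Multiset.map_map, Multiset.map_map, Finset.prod_map_val]
  rfl

/-- The reflected polynomial `G ∘ (−X)` over `S = K[X]`:
`(G ∘ (−X))(w) = C ((−1)^D a) · ∏_i (w + C ρ_i)`. -/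
theorem soloMI_eval_comp_neg_X (G : ℤ[X]) (hD : G.natDegree = D) (ρ : Fin D → K)
    (hρ : univ.val.map ρ = (G.map (Int.castRingHom K)).roots) (w : K[X]) :
    ((G.comp (-X)).map (algebraMap ℤ K[X])).eval w =
      C ((-1) ^ D * (G.leadingCoeff : K)) * ∏ i, (w + C (ρ i)) := by
  rw [map_comp, Polynomial.map_neg, map_X, eval_comp, eval_neg, eval_X,
    soloMI_eval_map_eq_prod G hD ρ hρ (-w)]
  have h : ∀ i, -w - C (ρ i) = -(w + C (ρ i)) := fun i => by ring
  simp_rw [h]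
  rw [Finset.prod_neg, Finset.card_univ, Fintype.card_fin, map_mul, map_pow, map_neg, map_one]
  ring

/-- Formal degree of the reflected polynomial pushed to `ℤ[V][X]`. -/
theorem soloMI_natDegree_comp_neg_X_le (G : ℤ[X]) (hD : G.natDegree = D) :
    ((G.comp (-X)).map (C : ℤ →+* ℤ[X])).natDegree ≤ D := by
  refine natDegree_map_le.trans (natDegree_comp_le.trans ?_)
  rw [hD, natDegree_neg, natDegree_X, mul_one]

/-- **Resultant step.**  For `g ∈ ℤ[V][X]` of formal degree `≤ n` and any ring map
`φ : ℤ[V] → K[X]`: `φ (Res(G, g; D, n)) = C (a ^ n) · ∏_i (g.map φ)(C ρ_i)`. -/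
theorem soloMI_map_resultant_eq (G : ℤ[X]) (hD : G.natDegree = D) (ρ : Fin D → K)
    (hρ : univ.val.map ρ = (G.map (Int.castRingHom K)).roots)
    (g : Polynomial ℤ[X]) {n : ℕ} (hg : g.natDegree ≤ n) (φ : ℤ[X] →+* K[X]) :
    φ (resultant (G.map C) g D n) =
      C ((G.leadingCoeff : K) ^ n) * ∏ i, (g.map φ).eval (C (ρ i)) := by
  have hGS : (G.map C).map φ = (G.map (Int.castRingHom K)).map C := by
    rw [Polynomial.map_map, Polynomial.map_map]
    congr 1
    exact RingHom.ext_int _ _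
  have hsplit : (G.map (Int.castRingHom K)).Splits := soloMI_splits_map G hD ρ hρ
  have hsplitS : ((G.map C).map φ).Splits := by rw [hGS]; exact hsplit.map C
  have hdegS : ((G.map C).map φ).natDegree = D := by
    rw [hGS, natDegree_map_eq_of_injective C_injective,
      natDegree_map_eq_of_injective (Int.castRingHom K).injective_int, hD]
  have hlcS : ((G.map C).map φ).leadingCoeff = C (G.leadingCoeff : K) := by
    rw [hGS, leadingCoeff_map_of_injective C_injective,
      leadingCoeff_map_of_injective (Int.castRingHom K).injective_int, eq_intCast]
  have hrootsS : ((G.map C).map φ).roots = univ.val.map (fun i => C (ρ i)) := by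
    rw [hGS, hsplit.roots_map C, ← hρ, Multiset.map_map]
    rfl
  have key := resultant_eq_prod_eval ((G.map C).map φ) (g.map φ) n
    (natDegree_map_le.trans hg) hsplitS
  rw [hdegS] at key
  rw [← resultant_map_map, key, hlcS, hrootsS, Multiset.map_map, ← map_pow, Finset.prod_map_val]
  rfl

end RootEnumeration

section Main

variable {K : Type*} [Field K] [CharZero K] {D₁ D₂ D₃ : ℕ}

/-- **Lemma M, polynomial form.**  With `κ = ((−1)^D₁ a₁) ^ (D₂ D₃) · a₂ ^ (D₁ D₃) ·
a₃ ^ (D₁ D₂)`, the polynomial `C κ · ∏_t (X + C (L t)) ∈ K[X]` comes from `ℤ[X]`. -/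
theorem soloMI_exists_map_eq_C_mul_prod (G₁ G₂ G₃ : ℤ[X]) (hD₁ : G₁.natDegree = D₁)
    (hD₂ : G₂.natDegree = D₂) (hD₃ : G₃.natDegree = D₃)
    (ρ₁ : Fin D₁ → K) (ρ₂ : Fin D₂ → K) (ρ₃ : Fin D₃ → K)
    (hρ₁ : univ.val.map ρ₁ = (G₁.map (Int.castRingHom K)).roots)
    (hρ₂ : univ.val.map ρ₂ = (G₂.map (Int.castRingHom K)).roots)
    (hρ₃ : univ.val.map ρ₃ = (G₃.map (Int.castRingHom K)).roots)
    (L : Fin D₁ × Fin D₂ × Fin D₃ → K) (hL : ∀ t, L t = ρ₁ t.1 + ρ₃ t.2.2 - 2 * ρ₂ t.2.1) :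
    ∃ P : ℤ[X], P.map (Int.castRingHom K) =
      C (((-1) ^ D₁ * (G₁.leadingCoeff : K)) ^ (D₂ * D₃) * (G₂.leadingCoeff : K) ^ (D₁ * D₃)
        * (G₃.leadingCoeff : K) ^ (D₁ * D₂)) * ∏ t, (X + C (L t)) := by
  -- names for the three constants
  obtain ⟨κ₁, hκ₁⟩ : ∃ κ₁ : K, κ₁ = (-1) ^ D₁ * (G₁.leadingCoeff : K) := ⟨_, rfl⟩
  obtain ⟨a₂, ha₂⟩ : ∃ a₂ : K, a₂ = (G₂.leadingCoeff : K) := ⟨_, rfl⟩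
  obtain ⟨a₃, ha₃⟩ : ∃ a₃ : K, a₃ = (G₃.leadingCoeff : K) := ⟨_, rfl⟩
  rw [← hκ₁, ← ha₂, ← ha₃]
  -- the three integer polynomials of the iterated resultant
  obtain ⟨P₁, hP₁⟩ : ∃ P₁ : ℤ[X], P₁ = G₁.comp (-X) := ⟨_, rfl⟩
  obtain ⟨g₂, hg₂⟩ : ∃ g₂ : Polynomial ℤ[X], g₂ = (P₁.map C).comp (C X - 2 * X) := ⟨_, rfl⟩
  obtain ⟨P₂, hP₂⟩ : ∃ P₂ : ℤ[X], P₂ = resultant (G₂.map C) g₂ D₂ D₁ := ⟨_, rfl⟩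
  obtain ⟨g₃, hg₃⟩ : ∃ g₃ : Polynomial ℤ[X], g₃ = (P₂.map C).comp (C X + X) := ⟨_, rfl⟩
  obtain ⟨P₃, hP₃⟩ : ∃ P₃ : ℤ[X], P₃ = resultant (G₃.map C) g₃ D₃ (D₁ * D₂) := ⟨_, rfl⟩
  -- Step A: the reflected first polynomial over `S = K[X]`
  have hA : ∀ w : K[X], (P₁.map (algebraMap ℤ K[X])).eval w = C κ₁ * ∏ i, (w + C (ρ₁ i)) := by
    intro w
    rw [hP₁, hκ₁]
    exact soloMI_eval_comp_neg_X G₁ hD₁ ρ₁ hρ₁ w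
  have hdeg₂ : g₂.natDegree ≤ D₁ := by
    rw [hg₂]
    refine natDegree_comp_le.trans ?_
    have h1 : (C X - 2 * X : Polynomial ℤ[X]).natDegree ≤ 1 := by
      refine (natDegree_sub_le _ _).trans (max_le ?_ ?_)
      · rw [natDegree_C]; exact zero_le_one
      · exact (natDegree_mul_le).trans (by rw [natDegree_X]; simp)
    calc (P₁.map C).natDegree * (C X - 2 * X : Polynomial ℤ[X]).natDegree
        ≤ D₁ * 1 :=
          Nat.mul_le_mul (by rw [hP₁]; exact soloMI_natDegree_comp_neg_X_le G₁ hD₁) h1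
      _ = D₁ := mul_one _
  -- Step B: the second resultant under any substitution `V ↦ v ∈ K[X]`
  have hB : ∀ φ : ℤ[X] →+* K[X], φ P₂ =
      C (a₂ ^ D₁) * ∏ j, (C κ₁ * ∏ i, (φ X - 2 * C (ρ₂ j) + C (ρ₁ i))) := by
    intro φ
    rw [hP₂, soloMI_map_resultant_eq G₂ hD₂ ρ₂ hρ₂ g₂ hdeg₂ φ, ← ha₂]
    congr 1
    refine Finset.prod_congr rfl (fun j _ => ?_)
    have hφC : φ.comp C = algebraMap ℤ K[X] := RingHom.ext_int _ _
    rw [hg₂, map_comp, Polynomial.map_map, hφC, eval_comp, Polynomial.map_sub,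
      Polynomial.map_mul, map_C, map_X, Polynomial.map_ofNat, eval_sub, eval_C, eval_mul,
      eval_ofNat, eval_X, hA]
  -- Step B': the degree of `P₂`
  have hdegP₂ : P₂.natDegree ≤ D₁ * D₂ := by
    have h := hB (mapRingHom (Int.castRingHom K))
    rw [coe_mapRingHom, map_X] at h
    rw [← natDegree_map_eq_of_injective (Int.castRingHom K).injective_int, h]
    refine (natDegree_C_mul_le _ _).trans ((natDegree_prod_le _ _).trans ?_)
    have hj : ∀ j : Fin D₂,
        (C κ₁ * ∏ i, (X - 2 * C (ρ₂ j) + C (ρ₁ i)) : K[X]).natDegree ≤ D₁ := by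
      intro j
      refine (natDegree_C_mul_le _ _).trans ((natDegree_prod_le _ _).trans ?_)
      have hi : ∀ i : Fin D₁, (X - 2 * C (ρ₂ j) + C (ρ₁ i) : K[X]).natDegree ≤ 1 := by
        intro i
        rw [show (X - 2 * C (ρ₂ j) + C (ρ₁ i) : K[X]) = X + C (ρ₁ i - 2 * ρ₂ j) by
          simp only [map_sub, map_mul, map_ofNat]; ring]
        exact (natDegree_X_add_C _).le
      calc ∑ i, (X - 2 * C (ρ₂ j) + C (ρ₁ i) : K[X]).natDegree ≤ ∑ _i : Fin D₁, 1 :=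
            Finset.sum_le_sum (fun i _ => hi i)
        _ = D₁ := by simp
    calc ∑ j, (C κ₁ * ∏ i, (X - 2 * C (ρ₂ j) + C (ρ₁ i)) : K[X]).natDegree
        ≤ ∑ _j : Fin D₂, D₁ := Finset.sum_le_sum (fun j _ => hj j)
      _ = D₁ * D₂ := by simp [mul_comm]
  have hdeg₃ : g₃.natDegree ≤ D₁ * D₂ := by
    rw [hg₃]
    refine natDegree_comp_le.trans ?_
    have h1 : (C X + X : Polynomial ℤ[X]).natDegree ≤ 1 := by
      refine (natDegree_add_le _ _).trans (max_le ?_ ?_)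
      · rw [natDegree_C]; exact zero_le_one
      · exact natDegree_X_le
    calc (P₂.map C).natDegree * (C X + X : Polynomial ℤ[X]).natDegree
        ≤ (D₁ * D₂) * 1 := Nat.mul_le_mul (natDegree_map_le.trans hdegP₂) h1
      _ = D₁ * D₂ := mul_one _
  -- Step C: the third resultant under `ℤ[V] → K[X]`, `V ↦ X`
  refine ⟨P₃, ?_⟩
  have hC := soloMI_map_resultant_eq G₃ hD₃ ρ₃ hρ₃ g₃ hdeg₃ (mapRingHom (Int.castRingHom K))
  rw [coe_mapRingHom] at hC
  rw [hP₃, hC, ← ha₃]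
  -- evaluate the factors
  have hfac : ∀ k : Fin D₃, (g₃.map (mapRingHom (Int.castRingHom K))).eval (C (ρ₃ k)) =
      C (a₂ ^ D₁) * ∏ j, (C κ₁ * ∏ i, (X + C (L (i, j, k)))) := by
    intro k
    have hψC : (mapRingHom (Int.castRingHom K)).comp C = algebraMap ℤ K[X] :=
      RingHom.ext_int _ _
    rw [hg₃, map_comp, Polynomial.map_map, hψC, Polynomial.map_add, map_C, map_X,
      coe_mapRingHom, map_X, eval_comp, eval_add, eval_C, eval_X, eval_map,
      ← coe_eval₂RingHom, hB]
    congr 1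
    refine Finset.prod_congr rfl (fun j _ => ?_)
    congr 1
    refine Finset.prod_congr rfl (fun i _ => ?_)
    rw [coe_eval₂RingHom, eval₂_X, hL]
    simp only [map_add, map_sub, map_mul, map_ofNat]
    ring
  simp_rw [hfac]
  -- collect constants and reorder the triple product
  rw [Finset.prod_mul_distrib, Finset.prod_const, Finset.card_univ, Fintype.card_fin]
  simp_rw [Finset.prod_mul_distrib, Finset.prod_const, Finset.card_univ, Fintype.card_fin]
  have htrip : (∏ t, (X + C (L t)) : K[X]) = ∏ k, ∏ j, ∏ i, (X + C (L (i, j, k))) := by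
    rw [Fintype.prod_prod_type, Finset.prod_comm, Fintype.prod_prod_type, Finset.prod_comm]
  rw [htrip]
  simp only [map_mul, map_pow]
  ring

/-- **Lemma M, algebraic core.**  `a₁ ^ (D₂ D₃) · a₂ ^ (D₁ D₃) · a₃ ^ (D₁ D₂) ·
∏_{t : L t ≠ 0} L t ∈ ℤ` (the coefficient of `X ^ #{t : L t = 0}` in
`soloMI_exists_map_eq_C_mul_prod`, up to the sign `(−1) ^ (D₁ D₂ D₃)`). -/
theorem soloMI_pow_mul_prod_eq_intCast [DecidableEq K] (G₁ G₂ G₃ : ℤ[X])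
    (hD₁ : G₁.natDegree = D₁) (hD₂ : G₂.natDegree = D₂) (hD₃ : G₃.natDegree = D₃)
    (ρ₁ : Fin D₁ → K) (ρ₂ : Fin D₂ → K) (ρ₃ : Fin D₃ → K)
    (hρ₁ : univ.val.map ρ₁ = (G₁.map (Int.castRingHom K)).roots)
    (hρ₂ : univ.val.map ρ₂ = (G₂.map (Int.castRingHom K)).roots)
    (hρ₃ : univ.val.map ρ₃ = (G₃.map (Int.castRingHom K)).roots)
    (L : Fin D₁ × Fin D₂ × Fin D₃ → K) (hL : ∀ t, L t = ρ₁ t.1 + ρ₃ t.2.2 - 2 * ρ₂ t.2.1) :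
    ∃ N : ℤ, (G₁.leadingCoeff : K) ^ (D₂ * D₃) * (G₂.leadingCoeff : K) ^ (D₁ * D₃)
      * (G₃.leadingCoeff : K) ^ (D₁ * D₂)
      * ∏ t ∈ (univ : Finset (Fin D₁ × Fin D₂ × Fin D₃)) with L t ≠ 0, L t = N := by
  obtain ⟨P, hP⟩ :=
    soloMI_exists_map_eq_C_mul_prod G₁ G₂ G₃ hD₁ hD₂ hD₃ ρ₁ ρ₂ ρ₃ hρ₁ hρ₂ hρ₃ L hL
  -- the non-vanishing forms `J` and the vanishing ones `Z`
  obtain ⟨J, hJ⟩ : ∃ J : Finset (Fin D₁ × Fin D₂ × Fin D₃),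
      J = univ.filter (fun t => L t ≠ 0) := ⟨_, rfl⟩
  obtain ⟨Z, hZ⟩ : ∃ Z : Finset (Fin D₁ × Fin D₂ × Fin D₃),
      Z = univ.filter (fun t => ¬ (L t ≠ 0)) := ⟨_, rfl⟩
  rw [← hJ]
  have hsplit : (∏ t, (X + C (L t)) : K[X]) = (∏ t ∈ J, (X + C (L t))) * X ^ #Z := by
    rw [hJ, hZ, ← Finset.prod_filter_mul_prod_filter_not univ (fun t => L t ≠ 0)]
    congr 1
    rw [← Finset.prod_const]
    refine Finset.prod_congr rfl (fun t ht => ?_)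
    rw [not_not.mp (Finset.mem_filter.mp ht).2, map_zero, add_zero]
  -- the coefficient of `X ^ #Z`
  have hcoeff : (P.map (Int.castRingHom K)).coeff #Z =
      ((-1) ^ D₁ * (G₁.leadingCoeff : K)) ^ (D₂ * D₃) * (G₂.leadingCoeff : K) ^ (D₁ * D₃)
        * (G₃.leadingCoeff : K) ^ (D₁ * D₂) * ∏ t ∈ J, L t := by
    rw [hP, hsplit, coeff_C_mul, coeff_mul_X_pow', if_pos le_rfl, Nat.sub_self,
      coeff_zero_eq_eval_zero, eval_prod]
    congr 1
    refine Finset.prod_congr rfl (fun t _ => ?_)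
    rw [eval_add, eval_X, eval_C, zero_add]
  have h1 : ((-1 : K) ^ (D₁ * (D₂ * D₃))) * (-1) ^ (D₁ * (D₂ * D₃)) = 1 := by
    rw [← pow_add, ← two_mul, pow_mul, neg_one_sq, one_pow]
  refine ⟨(-1) ^ (D₁ * (D₂ * D₃)) * P.coeff #Z, ?_⟩
  symm
  calc (((-1) ^ (D₁ * (D₂ * D₃)) * P.coeff #Z : ℤ) : K)
      = (-1) ^ (D₁ * (D₂ * D₃)) * (P.map (Int.castRingHom K)).coeff #Z := by
        rw [coeff_map, eq_intCast, Int.cast_mul, Int.cast_pow, Int.cast_neg, Int.cast_one]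
    _ = (-1) ^ (D₁ * (D₂ * D₃)) * (-1) ^ (D₁ * (D₂ * D₃))
          * ((G₁.leadingCoeff : K) ^ (D₂ * D₃) * (G₂.leadingCoeff : K) ^ (D₁ * D₃)
            * (G₃.leadingCoeff : K) ^ (D₁ * D₂) * ∏ t ∈ J, L t) := by
        rw [hcoeff, mul_pow, ← pow_mul]; ring
    _ = _ := by rw [h1, one_mul]

/-- **Lemma M (i), numerical form.**  Over `ℂ`, with `G₁, G₂, G₃ ≠ 0`:
`1 ≤ |a₁| ^ (D₂ D₃) · |a₂| ^ (D₁ D₃) · |a₃| ^ (D₁ D₂) · ∏_{t : L t ≠ 0} ‖L t‖`. -/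
theorem soloMI_one_le_abs_pow_mul_prod_norm (G₁ G₂ G₃ : ℤ[X]) (hG₁ : G₁ ≠ 0) (hG₂ : G₂ ≠ 0)
    (hG₃ : G₃ ≠ 0) (hD₁ : G₁.natDegree = D₁) (hD₂ : G₂.natDegree = D₂)
    (hD₃ : G₃.natDegree = D₃) (ρ₁ : Fin D₁ → ℂ) (ρ₂ : Fin D₂ → ℂ) (ρ₃ : Fin D₃ → ℂ)
    (hρ₁ : univ.val.map ρ₁ = (G₁.map (Int.castRingHom ℂ)).roots)
    (hρ₂ : univ.val.map ρ₂ = (G₂.map (Int.castRingHom ℂ)).roots)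
    (hρ₃ : univ.val.map ρ₃ = (G₃.map (Int.castRingHom ℂ)).roots)
    (L : Fin D₁ × Fin D₂ × Fin D₃ → ℂ) (hL : ∀ t, L t = ρ₁ t.1 + ρ₃ t.2.2 - 2 * ρ₂ t.2.1) :
    1 ≤ |(G₁.leadingCoeff : ℝ)| ^ (D₂ * D₃) * |(G₂.leadingCoeff : ℝ)| ^ (D₁ * D₃)
      * |(G₃.leadingCoeff : ℝ)| ^ (D₁ * D₂)
      * ∏ t ∈ (univ : Finset (Fin D₁ × Fin D₂ × Fin D₃)) with L t ≠ 0, ‖L t‖ := by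
  obtain ⟨N, hN⟩ :=
    soloMI_pow_mul_prod_eq_intCast G₁ G₂ G₃ hD₁ hD₂ hD₃ ρ₁ ρ₂ ρ₃ hρ₁ hρ₂ hρ₃ L hL
  have ha₁ : (G₁.leadingCoeff : ℂ) ≠ 0 := by exact_mod_cast leadingCoeff_ne_zero.mpr hG₁
  have ha₂ : (G₂.leadingCoeff : ℂ) ≠ 0 := by exact_mod_cast leadingCoeff_ne_zero.mpr hG₂
  have ha₃ : (G₃.leadingCoeff : ℂ) ≠ 0 := by exact_mod_cast leadingCoeff_ne_zero.mpr hG₃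
  have hN0 : N ≠ 0 := by
    rintro rfl
    rw [Int.cast_zero] at hN
    rcases mul_eq_zero.mp hN with h | h
    · rcases mul_eq_zero.mp h with h | h
      · rcases mul_eq_zero.mp h with h | h
        · exact pow_ne_zero _ ha₁ h
        · exact pow_ne_zero _ ha₂ h
      · exact pow_ne_zero _ ha₃ h
    · exact (Finset.prod_ne_zero_iff.mpr (fun t ht => (Finset.mem_filter.mp ht).2)) h
  have hnorm := congrArg norm hN
  simp only [norm_mul, norm_pow, Complex.norm_intCast, norm_prod] at hnorm
  rw [hnorm]
  exact_mod_cast Int.one_le_abs hN0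

end Main

end Summit.Schanuel.Schanuel.Theorems
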